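import Summits.NavierStokesRegularity.NavierStokesRegularity.Theorems.PalasekTowerBreakdownEpisodeBaseFreeRun

/-!
# `EpisodeBase` (crux stmt-NavierStokesRegularity-19179) from ANY strict-slot filler `Germ.LevelZeroData U ρ` and ONE
# FREE classical Navier–Stokes run from `U` meeting the first-window letter with margins — BY NAME

Cell `ns-blowup`, seat `ns-blowup-ecbridge-3` (g6; D-0074 GROUP C «BRIDGE SUPPORT», lineage `host_preparation`).
Route `PalasekTowerBreakdown`, crux `EpisodeBase`, line `slot` v5. Corollary of the FREE-RUN DOOR
(`palasekTowerBreakdown_episodeBase_of_lineGerm_freeRun`, this seat) at the explicit certificate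
`LevelZeroData.lineGermData` (width `h.width`, fade `h.fadeLen`, push `c₄ = 1`) of a strict-slot filler: the
`Classical.choose` constants `(σ₀, ε)` of the filler never reach the numerics obligation, so EVERY kernel
inhabitant of the strict slot (the tiny carrier `strictTinyProfile a`, the large carriers
`decoratedBlob b a + farPusher`, every amplifier design `strictTinyProfile a + W(· − c)` /
`+ curl A (· − c)` of the companion rule, the numeric demo `levelZeroData_demo`) is ONE FREE RUN away from
`EpisodeBase`. LABEL: E–C typing (KERNEL: theorems only; `--supports` stmt-NavierStokesRegularity-19179). WHAT
THIS IS NOT: not Navier–Stokes evidence — no free run meeting the letter is exhibited; nothing about `RungG 1` or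
blow-up is asserted.

* `palasekTowerBreakdown_episodeBase_of_levelZeroData_freeRun` — `Germ.LevelZeroData U ρ` + ONE classical
  finite-energy FREE run (`ν = 1`) on `[1, Host.τfirst]` from `v 1 = U` with margin `η > 0` on the cap and the
  three level-`1` faces in `‖x‖ ≤ ρ` ⟹ `EpisodeBase`.

References: S. Palasek, arXiv:2605.13827 §4 [cite: Palasek2026ElementaryModel, §4]; T. Tao, Anal. PDE 6 (2013),
Thm. 5.4 [cite: Tao2011, Thm. 5.4 (ii)+(iv)].
-/

noncomputable section

namespace Summit.NavierStokesRegularity.NavierStokesRegularity.Theorems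

open Set Function MeasureTheory Metric
open scoped ENNReal
open Summit.NavierStokesRegularity.NavierStokesRegularity.Theses
open Summit.NavierStokesRegularity.FluidComputer.PalasekTowerClayBridge
open Summit.NavierStokesRegularity.FluidComputer.PalasekTowerClayBridge.Germ
open Literature.Analysis.FluidPDE

/-- **`EpisodeBase` FROM A STRICT-SLOT FILLER AND ONE FREE RUN WITH MARGINS.** Let `h : Germ.LevelZeroData U ρ`
(a profile passing the level-`0` readouts and the STRICT anchor test — every kernel inhabitant of the slot), and
let `(v, q)` be ONE classical finite-energy solution of the UNFORCED Navier–Stokes system (`ν = 1`) on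
`[1, Host.τfirst]` from `v 1 = U` such that, for some `η > 0`, `‖v t x‖ ≤ (5/3) Y₁ − η` on the window and at
`Host.τfirst`, in `‖x‖ ≤ ρ`: `Y₁ + η ≤ ‖v τfirst x‖`, `A₁ + η ≤ ‖Dv(τfirst) x‖`, and an `N₁`-core loop of
circulation `≥ N₁^{β−2} + η`. Then `EpisodeBase`. (The filler's explicit certificate `h.lineGermData` at push
`c₄ = 1` feeds `palasekTowerBreakdown_episodeBase_of_lineGerm_freeRun`; its `Classical.choose` width and fade are
consumed inside the kernel.) [cite: Palasek2026ElementaryModel, §4] [cite: Tao2011, Thm. 5.4 (ii)+(iv)] -/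
theorem palasekTowerBreakdown_episodeBase_of_levelZeroData_freeRun
    {U : EuclideanSpace ℝ (Fin 3) → EuclideanSpace ℝ (Fin 3)} {ρ : ℝ} (h : LevelZeroData U ρ)
    {v : ℝ → EuclideanSpace ℝ (Fin 3) → EuclideanSpace ℝ (Fin 3)} {q : ℝ → EuclideanSpace ℝ (Fin 3) → ℝ}
    (hv : IsClassicalNSSolutionOn (Icc 1 Host.τfirst) 1 0 v q) (hv1 : v 1 = U)
    (hvE : ∃ C : ℝ≥0∞, C < ⊤ ∧ ∀ t ∈ Icc (1 : ℝ) Host.τfirst, ∫⁻ x, ‖v t x‖ₑ ^ 2 ≤ C)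
    {η : ℝ} (hη : 0 < η)
    (hcap : ∀ t ∈ Icc (1 : ℝ) Host.τfirst, ∀ x, ‖v t x‖ ≤ 5 / 3 * TowerRates.wide.Y 1 - η)
    (hspeed : ∃ x, ‖x‖ ≤ ρ ∧ TowerRates.wide.Y 1 + η ≤ ‖v Host.τfirst x‖)
    (hstrain : ∃ x, ‖x‖ ≤ ρ ∧ TowerRates.wide.A 1 + η ≤ ‖fderiv ℝ (v Host.τfirst) x‖)
    (hcore : ∃ (x : EuclideanSpace ℝ (Fin 3)) (γ : ℝ → EuclideanSpace ℝ (Fin 3)),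
      ‖x‖ ≤ ρ ∧ ContDiff ℝ 1 γ ∧ γ 0 = γ 1 ∧
      (∀ s ∈ Icc (0 : ℝ) 1, γ s ∈ closedBall x (1 / TowerRates.wide.N 1)) ∧
      (∀ s ∈ Icc (0 : ℝ) 1, ‖deriv γ s‖ ≤ 8 * Real.pi / TowerRates.wide.N 1) ∧
      TowerRates.wide.N 1 ^ (TowerRates.wide.β - 2) + η ≤ circulation (v Host.τfirst) γ) :
    PalasekTowerBreakdown.EpisodeBase :=
  palasekTowerBreakdown_episodeBase_of_lineGerm_freeRun (h.lineGermData one_pos le_rfl) hv hv1 hvE hη hcap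
    hspeed hstrain hcore

end Summit.NavierStokesRegularity.NavierStokesRegularity.Theorems

end
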